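import Literature.NumberTheory.Automorphic.AutomorphicRepsGLCuspidalL2Step3bHolds
import Literature.NumberTheory.Automorphic.AutomorphicRepsGLCuspidalL2Step2Holds
import Literature.NumberTheory.Automorphic.AutomorphicRepsGLCuspidalL2Step3Holds
import Literature.NumberTheory.Automorphic.PairLFunctionPolesRepDataRealisation
import Literature.NumberTheory.Automorphic.AutomorphicRepsGLCleanModel
import Literature.NumberTheory.Automorphic.AutomorphicRepsGLSatakeProofs
import Literature.NumberTheory.Automorphic.UnramifiedHeckeScalarsFlathProofs
import Literature.NumberTheory.Automorphic.SatakeParameterTrivialBound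
import Literature.NumberTheory.Automorphic.AutomorphicRepsGLAnalyticVectors
import Literature.NumberTheory.Automorphic.BaseChangeCyclicCuspidalProofs
import Mathlib.Analysis.InnerProductSpace.Projection.Basic
import HarnessLib

/-!
# The two notions of Satake parameter agree along `W = W' ⊕ V_Π` (Borel–Jacquet 1979, 4.6):
# proof of `hasSatakeParamAt_iff_L2`

Topic `NumberTheory/Automorphic`; namespace `Literature.NumberTheory.Automorphic`. A proof file
(theorems only: no definition, no named fact, no instance), sibling of `AutomorphicRepsGL`, which
states the named fact

* `Literature.NumberTheory.Automorphic.hasSatakeParamAt_iff_L2 hcpt μ` (Borel–Jacquet 1979, 4.6):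
  if the cuspidal automorphic representation datum `π = W / W'` of `GL_n(𝔸_K)` is associated with
  the cuspidal `Π ≤ L²_cusp(GL_n(𝔸_K) ⧸ A_G GL_n(K), μ)` (`IsAssociatedL2 π Π`: `W = W' + V_Π`,
  `V_Π = formsOfL2 hcpt μ Π` the automorphic forms `g ↦ f [g⁻¹]`, `[f] ∈ Π`), then at EVERY finite
  place `v` and for every multiset `α`, `α` is a Satake parameter of `π` at `v` (Hecke eigenvalues
  modulo `W'` of a `K(𝔫)`-invariant form in `W ∖ W'`, `AutomorphicRepData.HasSatakeParamAt`) iff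
  `α` is a Satake parameter of `Π` at `v` in the `L²` sense (`HasSatakeParameterAt Π K(𝔫) v ϖ α`:
  Hecke eigenvalues of a non-zero `K(𝔫)`-fixed `L²`-vector) for some level `𝔫 ≠ 0` prime to `v`
  and some uniformizer `ϖ`.

The tree proved this almost everywhere (`hasSatakeParamAt_iff_L2_eventually`,
`LanglandsTunnellBridgeTwoFacts`: through Satake FAMILIES, which are almost-everywhere objects);
here it is proved at every place (`hasSatakeParamAt_iff_L2_holds`), from theorems of the tree only:

1. `formsOfL2_inf_W'_eq_bot` — **`V_Π ∩ W' = 0`** along an association: `V_Π` is an irreducible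
   stable space (`AutomorphicRepsGL.formsOfL2_irreducible_holds`, Harish-Chandra) and
   `V_Π ⊄ W'` since `W' < W = W' + V_Π`.
2. "`⇒`" (`exists_hasSatakeParameterAt_of_hasSatakeParamAt`): the `V_Π`-component `ψ` of a
   `K(𝔫)`-invariant Hecke eigenform `φ ∈ W ∖ W'` modulo `W'` is `K(𝔫)`-invariant and an EXACT
   eigenform (`r(u) ψ - ψ`, `T ψ - c ψ ∈ V_Π ∩ W' = 0`, both spaces being stable under the finite
   sums of finite-adelic right translations `r(u)`, `[K(𝔫) t_{v,i} K(𝔫)]`), and `ψ = invQuot f ≠ 0`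
   with `[f] ∈ Π^{K(𝔫)}` a Hecke eigenvector in `L²` (`invQuot` intertwines right translation with
   `R` and is injective: `heckeOperatorAt_eq_smul_of_heckeOperator_invQuot_eq_smul` of
   `BaseChangeCyclicCuspidalProofs`).
3. "`⇐`" (`hasSatakeParamAt_of_hasSatakeParameterAt`): (a) a NON-ZERO `K(𝔫)`-INVARIANT FORM in
   `V_Π` (`exists_invQuot_mem_formsOfL2_rightTranslation_eq`): the orthogonal projection `e` of
   `L²` onto the closed subspace of `K(𝔫)`-fixed classes is, on the class of a form of some level,
   the finite average over `K(𝔫) / (K(𝔫) ∩ U₀)` (unitarity of `R`), so it maps the classes `[V_Π]`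
   into themselves; `[V_Π]` is dense in `Π` (`AutomorphicRepsGL.le_topologicalClosure_l2OfForms_formsOfL2`
   with Steps 1, 2, 3a of Borel–Jacquet 4.6, all theorems of the tree), and `e` fixes the given
   non-zero `K(𝔫)`-fixed vector of `Π`, so `e [V_Π] ≠ 0`; (b) on `Π^{K(𝔫)}` the operators
   `T_{v,i}` act by scalars (`Flath1979_heckeOperatorAt_ofLocal_eq_smul_holds`), necessarily the
   given eigenvalues `q_v^{i(n-i)/2} e_i(α)`, so the class of that form is an `L²` eigenvector, and
   the `L²` eigen-equation is a pointwise one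
   (`heckeOperator_invQuot_eq_smul_of_heckeOperatorAt_eq_smul`); the form lies in `W ⊇ V_Π` and not
   in `W'` by 1.

## References

* A. Borel, H. Jacquet, *Automorphic forms and automorphic representations*, Proc. Sympos. Pure
  Math. 33 (Corvallis 1977), Part 1 (1979), §4.6 (the dictionary between `L²_cusp` and
  `(𝔤, K_∞) × G(𝔸_f)`-modules of cusp forms; "the two notions of automorphic representation
  coincide for cuspidal representations"). [BorelJacquet1979]
* Harish-Chandra, *Representations of a semisimple Lie group on a Banach space. I*, Trans. AMS 75
  (1953), Thm. 5 (p. 228). [HarishChandraTAMS1953]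
* D. Flath, *Decomposition of representations into tensor products*, Proc. Sympos. Pure Math. 33,
  Part 1 (1979), Thm. 3. [Flath1979]
* D. Bump, *Automorphic Forms and Representations* (1997), §3.3, Thm. 3.3.4. [Bump1997]
-/

noncomputable section

open scoped MatrixGroups Topology Classical InnerProductSpace
open NumberField IsDedekindDomain MeasureTheory Filter

namespace Literature.NumberTheory.Automorphic

open AdelicGroupData

variable {n : ℕ} {K : Type} [Field K] [NumberField K] {hcpt : isCompact_glFiniteIntegralLevel n K}
  {μ : Measure (gl n K).automorphicQuotient} [(gl n K).IsAutomorphicMeasure μ]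

/-! ### 0. Levels are finite-adelic -/

omit [(gl n K).IsAutomorphicMeasure μ] in
/-- Elements of a principal congruence subgroup `K(𝔫) = {1} × K_f(𝔫)` are finite-adelic elements
of the `GL_n` datum (`K(𝔫) ≤ {1} × GL_n(𝒪̂_K)` and `GLn.ofFinite ∘ GLn.sndHom = id` there).
[folklore] -/
theorem mem_finiteAdelic_of_mem_principalCongruenceLevel {𝔫 : Ideal (𝓞 K)}
    {k : (gl n K).Adelic} (hk : k ∈ principalCongruenceLevel n K 𝔫) :
    k ∈ (AutomorphyDatum.gl n K hcpt).finiteAdelic :=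
  ⟨GLn.sndHom n K k, GLn.ofFinite_sndHom_of_mem (principalCongruenceLevel_le n K 𝔫 hk)⟩

/-! ### 1. `V_Π ∩ W' = 0` along an association -/

/-- **`V_Π ∩ W' = 0` along `W = W' + V_Π`.** If the cuspidal datum `π = W / W'` is associated with
the cuspidal `Π ≤ L²_cusp` (`IsAssociatedL2 π Π`), then `V_Π ⊓ W' = ⊥`: `V_Π ⊓ W'` is a stable
subspace of the IRREDUCIBLE stable space `V_Π` (`AutomorphicRepsGL.formsOfL2_irreducible_holds`,
`AutomorphicRepsGL.formsOfL2_isStableSubmodule_holds`), and it is not `V_Π`, for otherwise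
`W = W' + V_Π = W'`. So `W = W' ⊕ V_Π` and `W / W' ≅ V_Π`. Borel–Jacquet 1979, 4.6.
[cite: BorelJacquet1979, 4.6] -/
theorem formsOfL2_inf_W'_eq_bot {π : CuspidalAutomorphicRepData n K hcpt}
    {P : CuspidalAutomorphicRepGL n K μ} (h : IsAssociatedL2 π P) :
    formsOfL2 hcpt μ P.1 ⊓ π.1.W' = ⊥ := by
  have hVst : IsStableSubmodule (AutomorphyDatum.gl n K hcpt) (formsOfL2 hcpt μ P.1) :=
    AutomorphicRepsGL.formsOfL2_isStableSubmodule_holds hcpt μ P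
  rcases AutomorphicRepsGL.formsOfL2_irreducible_holds hcpt μ P (formsOfL2 hcpt μ P.1 ⊓ π.1.W')
      inf_le_left (hVst.inf π.1.stable') with hbot | htop
  · exact hbot
  · exfalso
    have hle : formsOfL2 hcpt μ P.1 ≤ π.1.W' := htop.symm.trans_le inf_le_right
    have hW : π.1.W ≤ π.1.W' := by
      rw [h]
      exact sup_le le_rfl hle
    exact absurd (le_antisymm hW π.1.lt.le) π.1.lt.ne'

/-- Along an association, a non-zero element of `V_Π` does not lie in `W'`. [cite: BorelJacquet1979, 4.6] -/
theorem not_mem_W'_of_mem_formsOfL2 {π : CuspidalAutomorphicRepData n K hcpt}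
    {P : CuspidalAutomorphicRepGL n K μ} (h : IsAssociatedL2 π P)
    {φ : (gl n K).Adelic → ℂ} (hφ : φ ∈ formsOfL2 hcpt μ P.1) (hφ0 : φ ≠ 0) : φ ∉ π.1.W' := by
  intro hφ'
  have hmem : φ ∈ formsOfL2 hcpt μ P.1 ⊓ π.1.W' := ⟨hφ, hφ'⟩
  rw [formsOfL2_inf_W'_eq_bot h, Submodule.mem_bot] at hmem
  exact hφ0 hmem

/-! ### 2. "`⇒`": Borel–Jacquet Satake parameters are `L²` Satake parameters -/

/-- **Borel–Jacquet → `L²`, at every place.** If `π = W / W'` is associated with the cuspidal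
`Π ≤ L²_cusp` and `α` is a Satake parameter of `π` at `v` — the Hecke eigenvalues modulo `W'` of a
`K(𝔫)`-invariant form `φ ∈ W ∖ W'`, `v ∤ 𝔫 ≠ 0`, uniformizer `ϖ` — then `α` is a Satake parameter
of `Π` at `v` with respect to `K(𝔫)` and `ϖ`: the `V_Π`-component `ψ` of `φ = φ' + ψ`
(`W = W' + V_Π`) is `K(𝔫)`-invariant and an exact eigenform, because `r(u) ψ - ψ` and `T ψ - c ψ`
lie in `V_Π ∩ W' = 0` (`formsOfL2_inf_W'_eq_bot`; `W'` and `V_Π` are stable under finite-adelic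
right translations and their finite sums `[K(𝔫) t_{v,i} K(𝔫)]`,
`heckeOperator_apply_mem_of_isStableSubmodule`), `ψ ≠ 0` as `φ ∉ W'`, and `ψ = invQuot f` with
`[f] ∈ Π^{K(𝔫)} ∖ 0` an `L²` eigenvector (`heckeOperatorAt_eq_smul_of_heckeOperator_invQuot_eq_smul`).
Borel–Jacquet 1979, 4.6. [cite: BorelJacquet1979, 4.6] -/
theorem exists_hasSatakeParameterAt_of_hasSatakeParamAt {π : CuspidalAutomorphicRepData n K hcpt}
    {P : CuspidalAutomorphicRepGL n K μ} (h : IsAssociatedL2 π P) {v : HeightOneSpectrum (𝓞 K)}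
    {α : Multiset ℂ} (hα : π.1.HasSatakeParamAt v α) :
    ∃ (𝔫 : Ideal (𝓞 K)) (ϖ : (v.adicCompletion K)ˣ), 𝔫 ≠ 0 ∧ ¬ v.asIdeal ∣ 𝔫 ∧
      HasSatakeParameterAt P.1 (principalCongruenceLevel n K 𝔫) v ϖ α := by
  obtain ⟨𝔫, ϖ, h𝔫, hv𝔫, hϖ, hcard, φ, hφW, hφW', hfix, hT⟩ := hα
  set V := formsOfL2 hcpt μ P.1 with hV
  set Kn : Subgroup (gl n K).Adelic := principalCongruenceLevel n K 𝔫 with hKn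
  set ρ : Representation ℂ (gl n K).Adelic ((gl n K).Adelic → ℂ) := rightTranslation (gl n K) with hρ
  have hVst : IsStableSubmodule (AutomorphyDatum.gl n K hcpt) V :=
    AutomorphicRepsGL.formsOfL2_isStableSubmodule_holds hcpt μ P
  have hinf : V ⊓ π.1.W' = ⊥ := formsOfL2_inf_W'_eq_bot h
  have hKn_fin : ∀ k ∈ Kn, k ∈ (AutomorphyDatum.gl n K hcpt).finiteAdelic := fun k hk =>
    mem_finiteAdelic_of_mem_principalCongruenceLevel hk
  -- the decomposition `φ = φ' + ψ`
  have hφsup : φ ∈ π.1.W' ⊔ V := by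
    rw [hV, ← h]
    exact hφW
  obtain ⟨φ', hφ', ψ, hψV, hsum⟩ := Submodule.mem_sup.1 hφsup
  -- `ψ ∉ W'`, in particular `ψ ≠ 0`
  have hψW' : ψ ∉ π.1.W' := fun hψ => hφW' (hsum ▸ add_mem hφ' hψ)
  have hψ0 : ψ ≠ 0 := fun h0 => hψW' (by rw [h0]; exact zero_mem _)
  -- `ψ` is `K(𝔫)`-invariant
  have hψfix : ∀ u ∈ Kn, ρ u ψ = ψ := by
    intro u hu
    have h1 : ρ u ψ - ψ ∈ V := sub_mem (hVst.finite_stable u (hKn_fin u hu) hψV) hψV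
    have h2 : ρ u ψ - ψ ∈ π.1.W' := by
      have e : ρ u ψ - ψ = -(ρ u φ' - φ') := by
        have hu' : ρ u φ = φ := hfix u hu
        rw [← hsum, map_add] at hu'
        linear_combination hu'
      rw [e]
      exact neg_mem (sub_mem (π.1.stable'.finite_stable u (hKn_fin u hu) hφ') hφ')
    have h3 : ρ u ψ - ψ ∈ V ⊓ π.1.W' := ⟨h1, h2⟩
    rw [hinf, Submodule.mem_bot, sub_eq_zero] at h3
    exact h3
  -- `ψ` is an exact Hecke eigenform
  have hψT : ∀ i ≤ n, heckeOperator ρ Kn (heckeDiagAt n K v ϖ i) ψ =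
      ((((Real.sqrt (v.residueCard : ℝ)) : ℝ) : ℂ) ^ (i * (n - i)) * α.esymm i) • ψ := by
    intro i hi
    have ht : (heckeDiagAt n K v ϖ i : (gl n K).Adelic) ∈ (AutomorphyDatum.gl n K hcpt).finiteAdelic := by
      rw [heckeDiagAt_eq_ofLocal_glDiagonal]
      exact GLn.ofLocal_mem_range_ofFinite v _
    have hfin := finite_orbit_heckeDiagAt (n := n) h𝔫 hv𝔫 hϖ i
    set T := heckeOperator ρ Kn (heckeDiagAt n K v ϖ i) with hTdef
    set c : ℂ := (((Real.sqrt (v.residueCard : ℝ)) : ℝ) : ℂ) ^ (i * (n - i)) * α.esymm i with hc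
    have h1 : T ψ - c • ψ ∈ V :=
      sub_mem (heckeOperator_apply_mem_of_isStableSubmodule hVst hKn_fin ht hfin hψV)
        (Submodule.smul_mem _ _ hψV)
    have h2 : T ψ - c • ψ ∈ π.1.W' := by
      have hφ'T : T φ' - c • φ' ∈ π.1.W' :=
        sub_mem (heckeOperator_apply_mem_of_isStableSubmodule π.1.stable' hKn_fin ht hfin hφ')
          (Submodule.smul_mem _ _ hφ')
      have e : T ψ - c • ψ = (T φ - c • φ) - (T φ' - c • φ') := by
        rw [← hsum, map_add, smul_add]
        abel
      rw [e]
      exact sub_mem (hT i hi) hφ'T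
    have h3 : T ψ - c • ψ ∈ V ⊓ π.1.W' := ⟨h1, h2⟩
    rw [hinf, Submodule.mem_bot, sub_eq_zero] at h3
    exact h3
  -- `ψ = invQuot f`, `[f] ∈ Π^{K(𝔫)} ∖ 0` an `L²` eigenvector
  obtain ⟨f, hf, hfP, rfl, -⟩ := exists_toLp_mem_of_mem_formsOfL2 hψV
  have hfP' : hf.toLp f ∈ P.1.toSubmodule := hfP
  have hfixf : ∀ u ∈ Kn, rightTranslation (gl n K) u (invQuot (gl n K) f) = invQuot (gl n K) f :=
    fun u hu => hψfix u hu
  have hFfix : (⟨hf.toLp f, hfP'⟩ : P.1.toSubmodule) ∈ P.1.fixedVectors Kn :=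
    toLp_mem_fixedVectors_of_rightTranslation_invQuot_eq hf hfP' hfixf
  have hF0 : (⟨hf.toLp f, hfP'⟩ : P.1.toSubmodule) ≠ 0 := by
    intro h0
    have h0' : hf.toLp f = 0 := congrArg Subtype.val h0
    have hf0 : f = 0 := eq_zero_of_toLp_eq_zero_of_invQuot_mem_formsOfL2 hf hψV h0'
    exact hψ0 (by rw [hf0]; rfl)
  refine ⟨𝔫, ϖ, h𝔫, hv𝔫, hϖ, hcard, ⟨hf.toLp f, hfP'⟩, hFfix, hF0, fun i hi => ?_⟩
  exact heckeOperatorAt_eq_smul_of_heckeOperator_invQuot_eq_smul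
    (finite_orbit_heckeDiagAt (n := n) h𝔫 hv𝔫 hϖ i) hf hfP' hfixf (hψT i hi)

/-! ### 3. A non-zero `K(𝔫)`-invariant form in `V_Π` (orthogonal projection, averaging, density) -/

/-- **A non-zero `K(𝔫)`-fixed vector of `Π` yields a non-zero `K(𝔫)`-invariant form in `V_Π`.**
Let `Π ≤ L²_cusp` be cuspidal with a non-zero `K(𝔫)`-fixed vector (`𝔫 ≠ 0`). Then some `f ∈ ℒ²(μ)`
with `[f] ∈ Π`, `[f] ≠ 0`, has `invQuot f ∈ V_Π` right `K(𝔫)`-invariant. Proof: let `e` be the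
orthogonal projection of `L²` onto the closed subspace `H` of `K(𝔫)`-fixed classes. For the class
`x = [g]` of `invQuot g ∈ V_Π` (invariant under an open `U₀ ≤ GL_n(𝔸_K^∞)`), the finite sum
`a = ∑_{q ∈ K(𝔫)/(K(𝔫) ∩ U₀)} R(q) x` lies in `H` (`subgroupQuotientSum_apply_mem_fixedPoints`) and in
`[V_Π]` (`V_Π` is stable under finite-adelic right translations), and `x - a / N ⟂ H` by unitarity of
`R`, so `e x = a / N ∈ [V_Π] ∩ H`. Since `[V_Π]` is dense in `Π`
(`AutomorphicRepsGL.le_topologicalClosure_l2OfForms_formsOfL2`, from Steps 1, 2, 3a of Borel–Jacquet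
4.6) and `e` fixes the given non-zero vector of `Π^{K(𝔫)} ⊆ H`, `e` does not kill `[V_Π]`; a class
`e x ≠ 0` is the class of a `K(𝔫)`-invariant element of `V_Π` (class-level invariance is pointwise
invariance for continuous representatives). Borel–Jacquet 1979, 4.6; Bushnell–Henniart §4.2 (the
idempotent `e_K`). [cite: BorelJacquet1979, 4.6] -/
theorem exists_invQuot_mem_formsOfL2_rightTranslation_eq (P : CuspidalAutomorphicRepGL n K μ)
    {𝔫 : Ideal (𝓞 K)} (h𝔫 : 𝔫 ≠ 0) {F : P.1.toSubmodule}
    (hF : F ∈ P.1.fixedVectors (principalCongruenceLevel n K 𝔫)) (hF0 : F ≠ 0) :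
    ∃ (f : (gl n K).automorphicQuotient → ℂ) (hf : MemLp f 2 μ),
      hf.toLp f ∈ P.1 ∧ hf.toLp f ≠ 0 ∧ invQuot (gl n K) f ∈ formsOfL2 hcpt μ P.1 ∧
        ∀ u ∈ principalCongruenceLevel n K 𝔫,
          rightTranslation (gl n K) u (invQuot (gl n K) f) = invQuot (gl n K) f := by
  set V := formsOfL2 hcpt μ P.1 with hV
  set L := l2OfForms (gl n K) μ V with hL
  set Kn : Subgroup (gl n K).Adelic := principalCongruenceLevel n K 𝔫 with hKn
  set R := (gl n K).rightRegular μ with hR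
  set ρL : Representation ℂ (gl n K).Adelic ((gl n K).L2 μ) := R.toRepresentation with hρL
  have hρL : ∀ (x : (gl n K).Adelic) (y : (gl n K).L2 μ), ρL x y = R x y := fun _ _ => rfl
  have hVst : IsStableSubmodule (AutomorphyDatum.gl n K hcpt) V :=
    AutomorphicRepsGL.formsOfL2_isStableSubmodule_holds hcpt μ P
  have hKn_fin : ∀ k ∈ Kn, k ∈ (AutomorphyDatum.gl n K hcpt).finiteAdelic := fun k hk =>
    mem_finiteAdelic_of_mem_principalCongruenceLevel hk
  -- the closed subspace `H` of `K(𝔫)`-fixed classes and its orthogonal projection `e`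
  let H : Submodule ℂ ((gl n K).L2 μ) :=
    { carrier := {y | ∀ u ∈ Kn, R u y = y}
      zero_mem' := fun u _ => map_zero _
      add_mem' := fun {a b} ha hb u hu => by rw [map_add, ha u hu, hb u hu]
      smul_mem' := fun c {a} ha u hu => by rw [map_smul, ha u hu] }
  have hHmem : ∀ {y : (gl n K).L2 μ}, y ∈ H ↔ ∀ u ∈ Kn, R u y = y := fun {y} => Iff.rfl
  have hHclosed : IsClosed (H : Set ((gl n K).L2 μ)) := by
    have : (H : Set ((gl n K).L2 μ)) = ⋂ u ∈ Kn, {y | R u y = y} := by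
      ext y
      simp only [Set.mem_iInter, Set.mem_setOf_eq]
      exact hHmem
    rw [this]
    exact isClosed_biInter fun u _ => isClosed_eq (R u).continuous continuous_id
  haveI : CompleteSpace H := hHclosed.completeSpace_coe
  set e := H.starProjection with he
  -- `e` on the class of an element of `V_Π`: a finite average, again in `[V_Π]`
  have he_mem : ∀ x ∈ L, e x ∈ L := by
    intro x hx
    obtain ⟨g, hg, rfl, hgV⟩ := hx
    -- a level `U₀` of the form `invQuot g`
    obtain ⟨U₀, hU₀, hU₀g⟩ := exists_isOpen_forall_rightTranslation_ofFinite_eq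
      (hVst.le_automorphicForms hgV)
    set N₀ : Subgroup Kn := (U₀.comap (GLn.sndHom n K)).subgroupOf Kn with hN₀
    haveI : N₀.FiniteIndex := finiteIndex_subgroupOf_principalCongruenceLevel h𝔫 hU₀
    have hKn_le : ∀ k ∈ Kn, k ∈ glIntegralLevel n K := fun k hk => principalCongruenceLevel_le n K 𝔫 hk
    -- `x = [g]` is fixed by `N₀`
    have hxN₀ : ∀ m : Kn, m ∈ N₀ → ρL (m : (gl n K).Adelic) (hg.toLp g) = hg.toLp g := by
      intro m hm
      have hm' : GLn.sndHom n K (m : (gl n K).Adelic) ∈ U₀ :=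
        Subgroup.mem_comap.1 (Subgroup.mem_subgroupOf.1 hm)
      have hfixm : rightTranslation (gl n K) (m : (gl n K).Adelic) (invQuot (gl n K) g) =
          invQuot (gl n K) g := by
        have := hU₀g _ hm'
        rwa [GLn.ofFinite_sndHom_of_mem (hKn_le _ m.2)] at this
      rw [hρL, hR, AdelicGroupData.rightRegular_apply, DomMulAct.mk_smul_toLp]
      have hfun : (fun x => g ((m : (gl n K).Adelic)⁻¹ • x)) = g := by
        refine invQuot_injective_gl ?_
        rw [invQuot_smul, hfixm]
      exact (MemLp.toLp_eq_toLp_iff _ hg).mpr (Filter.Eventually.of_forall fun x => congrFun hfun x)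
    -- the average `a`
    set a : (gl n K).L2 μ :=
      (∑ᶠ q : Kn ⧸ N₀, ρL ((q.out : Kn) : (gl n K).Adelic)) (hg.toLp g) with ha
    have haH : a ∈ H := by
      have := subgroupQuotientSum_apply_mem_fixedPoints ρL Kn N₀ hxN₀
      intro u hu
      rw [← hρL]
      exact (ρL.mem_fixedPoints Kn _).1 this u hu
    have haL : a ∈ L :=
      subgroupQuotientSum_apply_mem ρL Kn N₀
        (fun q hq y hy => rightRegular_apply_mem_l2OfForms (hVst.finite_stable q (hKn_fin q hq)) hy)
        (toLp_mem_l2OfForms hg hgV)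
    -- `e x = a / N`
    set N : ℕ := Nat.card (Kn ⧸ N₀) with hN
    have hN0 : (N : ℂ) ≠ 0 := Nat.cast_ne_zero.2 Nat.card_pos.ne'
    have hex : e (hg.toLp g) = (N : ℂ)⁻¹ • a := by
      refine Submodule.eq_starProjection_of_mem_of_inner_eq_zero (H.smul_mem _ haH) fun w hw => ?_
      -- `⟪a, w⟫ = N ⟪x, w⟫` for `w ∈ H` (unitarity of `R`)
      have hinner : ⟪a, w⟫_ℂ = (N : ℂ) * ⟪hg.toLp g, w⟫_ℂ := by
        haveI : Fintype (Kn ⧸ N₀) := Fintype.ofFinite _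
        rw [ha, finsum_eq_sum_of_fintype, LinearMap.sum_apply, sum_inner]
        have hterm : ∀ q : Kn ⧸ N₀,
            ⟪ρL ((q.out : Kn) : (gl n K).Adelic) (hg.toLp g), w⟫_ℂ = ⟪hg.toLp g, w⟫_ℂ := by
          intro q
          have hwq : R ((q.out : Kn) : (gl n K).Adelic) w = w := hw _ (q.out : Kn).2
          conv_lhs => rw [← hwq, hρL]
          exact ((gl n K).rightRegularIsometry μ ((q.out : Kn) : (gl n K).Adelic)).inner_map_map _ _
        rw [Finset.sum_congr rfl fun q _ => hterm q, Finset.sum_const, Finset.card_univ,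
          ← Nat.card_eq_fintype_card, nsmul_eq_mul]
      rw [inner_sub_left, inner_smul_left, hinner, map_inv₀, map_natCast, ← mul_assoc,
        inv_mul_cancel₀ hN0, one_mul, sub_self]
    rw [hex]
    exact L.smul_mem _ haL
  -- density: `Π ≤ Cl [V_Π]`, so `e` does not kill `[V_Π]`
  have hdense : P.1.toSubmodule ≤ L.topologicalClosure :=
    AutomorphicRepsGL.le_topologicalClosure_l2OfForms_formsOfL2
      (AutomorphicRepsGL.formsOfL2_ne_bot_holds hcpt μ)
      (AutomorphicRepsGL.formsOfL2_isStableSubmodule_holds hcpt μ)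
      (AutomorphicRepsGL.formsOfL2_closure_exp_invariant_holds hcpt μ) P
  have hFH : (F : (gl n K).L2 μ) ∈ H := by
    intro u hu
    have := (P.1.mem_fixedVectors Kn F).1 hF u hu
    have h' := congrArg Subtype.val this
    rwa [ContRepresentation.ClosedSubrep.coe_toContRep_apply] at h'
  have heF : e (F : (gl n K).L2 μ) = F := Submodule.starProjection_eq_self_iff.2 hFH
  have hex0 : ∃ x ∈ L, e x ≠ 0 := by
    by_contra hall
    push Not at hall
    have hker : L ≤ (LinearMap.ker (e : (gl n K).L2 μ →ₗ[ℂ] (gl n K).L2 μ)) := fun x hx =>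
      LinearMap.mem_ker.2 (hall x hx)
    have hkerc : L.topologicalClosure ≤ LinearMap.ker (e : (gl n K).L2 μ →ₗ[ℂ] (gl n K).L2 μ) :=
      L.topologicalClosure_minimal hker (e.isClosed_ker)
    have hF' : e (F : (gl n K).L2 μ) = 0 := LinearMap.mem_ker.1 (hkerc (hdense F.2))
    rw [heF] at hF'
    exact hF0 (Subtype.ext hF')
  obtain ⟨x, hxL, hx0⟩ := hex0
  -- the class `e x ∈ [V_Π] ∩ H`, non-zero, has a `K(𝔫)`-invariant continuous representative
  obtain ⟨f, hf, hfe, hfV⟩ := he_mem x hxL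
  have hfP : hf.toLp f ∈ P.1 := l2OfForms_le_of_le_formsOfL2 (le_refl V) (toLp_mem_l2OfForms hf hfV)
  have heH : e x ∈ H := H.starProjection_apply_mem x
  refine ⟨f, hf, hfP, hfe ▸ hx0, hfV, fun u hu => ?_⟩
  have hcl : R u (hf.toLp f) = hf.toLp f := by rw [hfe]; exact heH u hu
  rw [hR, AdelicGroupData.rightRegular_apply, DomMulAct.mk_smul_toLp] at hcl
  have hae := (MemLp.toLp_eq_toLp_iff _ hf).1 hcl
  have hcont : Continuous f := continuous_of_continuous_invQuot (continuous_of_mem_formsOfL2 hfV)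
  have heq := Measure.eq_of_ae_eq hae (hcont.comp (continuous_const_smul _)) hcont
  rw [← invQuot_smul]
  exact congrArg (invQuot (gl n K)) heq

/-! ### 4. "`⇐`": `L²` Satake parameters are Borel–Jacquet Satake parameters -/

/-- **Flath's scalars are the given eigenvalues.** If `Π` has the `L²` Satake parameter `α` at `v`
with respect to `K(𝔫)` (`v ∤ 𝔫 ≠ 0`) and the uniformizer `ϖ`, then EVERY `K(𝔫)`-fixed vector of `Π`
is an eigenvector of `T_{v,i}(ϖ)` with eigenvalue `q_v^{i(n-i)/2} e_i(α)`, `i ≤ n`: the unramified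
Hecke operators act on `Π^{K(𝔫)}` by scalars (`Flath1979_heckeOperatorAt_ofLocal_eq_smul_holds`),
which are read off the given eigenvector. Flath 1979, Thm. 3. [cite: Flath1979, Thm. 3] -/
theorem HasSatakeParameterAt.heckeOperatorAt_eq_smul_of_mem_fixedVectors
    (P : CuspidalAutomorphicRepGL n K μ) {𝔫 : Ideal (𝓞 K)} (h𝔫 : 𝔫 ≠ 0)
    {v : HeightOneSpectrum (𝓞 K)} (hv : ¬ v.asIdeal ∣ 𝔫) {ϖ : (v.adicCompletion K)ˣ}
    {α : Multiset ℂ} (hα : HasSatakeParameterAt P.1 (principalCongruenceLevel n K 𝔫) v ϖ α)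
    {G : P.1.toSubmodule} (hG : G ∈ P.1.fixedVectors (principalCongruenceLevel n K 𝔫))
    {i : ℕ} (hi : i ≤ n) :
    heckeOperatorAt P.1 (principalCongruenceLevel n K 𝔫) (heckeDiagAt n K v ϖ i) G =
      ((((Real.sqrt (v.residueCard : ℝ)) : ℝ) : ℂ) ^ (i * (n - i)) * α.esymm i) • G := by
  obtain ⟨-, -, f, hf, hf0, hfα⟩ := hα
  obtain ⟨c, hc⟩ : ∃ c : ℂ, ∀ f' ∈ P.1.fixedVectors (principalCongruenceLevel n K 𝔫),
      heckeOperatorAt P.1 (principalCongruenceLevel n K 𝔫) (heckeDiagAt n K v ϖ i) f' = c • f' := by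
    rw [heckeDiagAt_eq_ofLocal_glDiagonal]
    exact Flath1979_heckeOperatorAt_ofLocal_eq_smul_holds P h𝔫 hv _
  have h1 := hfα i hi
  rw [hc f hf] at h1
  have e1 : c = _ := smul_left_injective ℂ hf0 h1
  rw [hc G hG, e1]

/-- **`L²` → Borel–Jacquet, at every place.** If `π = W / W'` is associated with the cuspidal
`Π ≤ L²_cusp` and `Π` has the `L²` Satake parameter `α` at `v` with respect to `K(𝔫)`, `v ∤ 𝔫 ≠ 0`,
and `ϖ`, then `α` is a Satake parameter of `π` at `v`: a non-zero `K(𝔫)`-invariant form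
`φ = invQuot f ∈ V_Π` exists (`exists_invQuot_mem_formsOfL2_rightTranslation_eq`), its class
`[f] ∈ Π^{K(𝔫)}` is an eigenvector of the `T_{v,i}(ϖ)` with the eigenvalues `q_v^{i(n-i)/2} e_i(α)`
(Flath's scalars), this `L²` identity is the pointwise identity for `φ`
(`heckeOperator_invQuot_eq_smul_of_heckeOperatorAt_eq_smul`), and `φ ∈ W ⊇ V_Π`, `φ ∉ W'`
(`V_Π ∩ W' = 0`). Borel–Jacquet 1979, 4.6; Flath 1979, Thm. 3. [cite: BorelJacquet1979, 4.6] -/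
theorem hasSatakeParamAt_of_hasSatakeParameterAt {π : CuspidalAutomorphicRepData n K hcpt}
    {P : CuspidalAutomorphicRepGL n K μ} (h : IsAssociatedL2 π P) {v : HeightOneSpectrum (𝓞 K)}
    {𝔫 : Ideal (𝓞 K)} (h𝔫 : 𝔫 ≠ 0) (hv : ¬ v.asIdeal ∣ 𝔫) {ϖ : (v.adicCompletion K)ˣ}
    {α : Multiset ℂ} (hα : HasSatakeParameterAt P.1 (principalCongruenceLevel n K 𝔫) v ϖ α) :
    π.1.HasSatakeParamAt v α := by
  have hα' := hα
  obtain ⟨hϖ, hcard, F, hF, hF0, -⟩ := hα'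
  obtain ⟨f, hf, hfP, hf0, hfV, hfix⟩ :=
    exists_invQuot_mem_formsOfL2_rightTranslation_eq (hcpt := hcpt) P h𝔫 hF hF0
  have hfP' : hf.toLp f ∈ P.1.toSubmodule := hfP
  have hGfix : (⟨hf.toLp f, hfP'⟩ : P.1.toSubmodule) ∈
      P.1.fixedVectors (principalCongruenceLevel n K 𝔫) :=
    toLp_mem_fixedVectors_of_rightTranslation_invQuot_eq hf hfP' hfix
  have hcont : Continuous f := continuous_of_continuous_invQuot (continuous_of_mem_formsOfL2 hfV)
  have hφW : invQuot (gl n K) f ∈ π.1.W := by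
    rw [h]
    exact Submodule.mem_sup_right hfV
  have hφ0 : invQuot (gl n K) f ≠ 0 := by
    intro h0
    have hz : f = 0 := invQuot_injective_gl (by rw [h0]; rfl)
    subst hz
    exact hf0 (MemLp.toLp_zero hf)
  have hφW' : invQuot (gl n K) f ∉ π.1.W' := not_mem_W'_of_mem_formsOfL2 h hfV hφ0
  refine ⟨𝔫, ϖ, h𝔫, hv, hϖ, hcard, invQuot (gl n K) f, hφW, hφW', hfix, fun i hi => ?_⟩
  have hL2 := hα.heckeOperatorAt_eq_smul_of_mem_fixedVectors P h𝔫 hv hGfix hi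
  rw [heckeOperator_invQuot_eq_smul_of_heckeOperatorAt_eq_smul
    (finite_orbit_heckeDiagAt (n := n) h𝔫 hv hϖ i) hf hfP' hcont hfix hL2, sub_self]
  exact Submodule.zero_mem _

/-! ### 5. The named fact holds -/

variable (hcpt μ) in
/-- **Borel–Jacquet 1979, 4.6: the two notions of Satake parameter agree — discharge of the named
fact `hasSatakeParamAt_iff_L2 hcpt μ`.** If `π = W / W'` is associated with `Π ≤ L²_cusp`, then at
every finite place `v`, `α` is a Satake parameter of `π` at `v` (Hecke eigenvalues modulo `W'` of a
level-`K(𝔫)` form in `W ∖ W'`) iff `α` is a Satake parameter of `Π` at `v` in the `L²` sense for some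
`𝔫 ≠ 0` prime to `v` and some uniformizer (`exists_hasSatakeParameterAt_of_hasSatakeParamAt`,
`hasSatakeParamAt_of_hasSatakeParameterAt`). Borel–Jacquet 1979, 4.6; Bump 1997, §3.3.
[cite: BorelJacquet1979, 4.6] -/
theorem hasSatakeParamAt_iff_L2_holds : hasSatakeParamAt_iff_L2 hcpt μ := by
  intro π P h v α
  constructor
  · exact exists_hasSatakeParameterAt_of_hasSatakeParamAt h
  · rintro ⟨𝔫, ϖ, h𝔫, hv, hα⟩
    exact hasSatakeParamAt_of_hasSatakeParameterAt h h𝔫 hv hα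

/-- Consequently (Borel–Jacquet 1979, 4.6, unconditionally): along an association `π` is unramified
at `v` iff `Π` is (`isUnramifiedAt_iff_L2` fed with `hasSatakeParamAt_iff_L2_holds`).
[cite: BorelJacquet1979, 4.6] -/
theorem isUnramifiedAt_iff_L2_holds {π : CuspidalAutomorphicRepData n K hcpt}
    {P : CuspidalAutomorphicRepGL n K μ} (h : IsAssociatedL2 π P) (v : HeightOneSpectrum (𝓞 K)) :
    π.1.IsUnramifiedAt v ↔ Automorphic.IsUnramifiedAt P.1 v :=
  isUnramifiedAt_iff_L2 (hasSatakeParamAt_iff_L2_holds hcpt μ) h v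

end Literature.NumberTheory.Automorphic

end
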